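import Summits.MatrixMultiplication.MatrixMultiplication.Theses.LevelGradedCohnUmans

/-!
# `LevelTwoBeatsCubes` (crux stmt-MatrixMultiplication-7612, route LevelGradedCohnUmans):
# the 2-token space `J₂ ≤ ℂ^{𝔖ₙ}` — invariance and an elementary dimension bound

Negative-side support file of the crux disprover (cdisprove seat); everything `sorry`-free.

* `J2 n = span {g ↦ [g ∘ p = q] : p q : Fin 2 → Fin n}` (= Ellis–Friedgut–Pilpel's `V₂`); the
  crux's test functions `g ↦ Σ_p c_p (g ∘ p)` lie in it (`tok_mem`); it is invariant under right and
  left translation (`comp_right_mem`, `comp_left_mem`); `dim J₂ ≤ n!` (`finrank_J2_le_factorial`).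
* `finrank_J2_succ_le` — for `n = m + 1`: `dim J₂ ≤ 1 + (m² + C(m,2)·(m² - m))`, by an explicit
  spanning family (the constant, the one-token indicators `[g i = a]` with `i, a < m`, the
  two-token indicators `[g i = a ∧ g j = b]` with `i < j < m`, `a ≠ b < m`): the last index/value is
  eliminated with `Σ_a [g i = a] = 1 = Σ_i [g i = a]`, `Σ_b [g i = a ∧ g j = b] = [g i = a] =
  Σ_j [g i = a ∧ g j = b]`, and `[g i = a ∧ g j = b] = [g j = b ∧ g i = a]`.  (The sharp value is
  `Σ_{λ₁ ≥ n-2} (f^λ)² = 1+(n-1)²+(n(n-3)/2)²+((n-1)(n-2)/2)²`, smaller by `n²-3n+1`; not needed.)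
-/

namespace Summit.MatrixMultiplication.MatrixMultiplication.Theorems.LevelTwoBeatsCubes.Negative

open Module

section TokenSpace

variable (n : ℕ)

/-- Generator of the 2-token space: the indicator of `g ∘ p = q`. -/
def gen (pq : (Fin 2 → Fin n) × (Fin 2 → Fin n)) : Equiv.Perm (Fin n) → ℂ :=
  fun g => if ⇑g ∘ pq.1 = pq.2 then 1 else 0

/-- The 2-token space `J₂ = span {g ↦ [g ∘ p = q]}` (= Ellis–Friedgut–Pilpel's `V₂`). -/
def J2 : Submodule ℂ (Equiv.Perm (Fin n) → ℂ) := Submodule.span ℂ (Set.range (gen n))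

variable {n}

/-- Every 2-token test function `g ↦ Σ_p c_p (g ∘ p)` lies in `J₂`. -/
theorem tok_mem (c : (Fin 2 → Fin n) → (Fin 2 → Fin n) → ℂ) :
    (fun g : Equiv.Perm (Fin n) => ∑ p, c p (⇑g ∘ p)) ∈ J2 n := by
  classical
  have h : (fun g : Equiv.Perm (Fin n) => ∑ p, c p (⇑g ∘ p)) =
      ∑ p : Fin 2 → Fin n, ∑ q : Fin 2 → Fin n, c p q • gen n (p, q) := by
    funext g
    simp only [Finset.sum_apply, Pi.smul_apply, smul_eq_mul, gen, mul_ite, mul_one, mul_zero]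
    refine Finset.sum_congr rfl fun p _ => ?_
    rw [Finset.sum_ite_eq]
    simp
  rw [h]
  exact Submodule.sum_mem _ fun p _ => Submodule.sum_mem _ fun q _ =>
    Submodule.smul_mem _ _ (Submodule.subset_span ⟨(p, q), rfl⟩)

/-- `J₂` is invariant under right translation. -/
theorem comp_right_mem (f : Equiv.Perm (Fin n) → ℂ) (hf : f ∈ J2 n) (h : Equiv.Perm (Fin n)) :
    (fun g => f (g * h)) ∈ J2 n := by
  have hmap : (J2 n).map (LinearMap.funLeft ℂ ℂ fun g : Equiv.Perm (Fin n) => g * h) ≤ J2 n := by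
    unfold J2
    rw [Submodule.map_span, Submodule.span_le]
    rintro _ ⟨_, ⟨pq, rfl⟩, rfl⟩
    refine Submodule.subset_span ⟨(⇑h ∘ pq.1, pq.2), ?_⟩
    funext g
    simp only [gen, LinearMap.funLeft_apply, Equiv.Perm.coe_mul, Function.comp_assoc]
    split_ifs <;> rfl
  exact hmap (Submodule.mem_map_of_mem hf)

/-- `J₂` is invariant under left translation. -/
theorem comp_left_mem (f : Equiv.Perm (Fin n) → ℂ) (hf : f ∈ J2 n) (h : Equiv.Perm (Fin n)) :
    (fun g => f (h * g)) ∈ J2 n := by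
  have hmap : (J2 n).map (LinearMap.funLeft ℂ ℂ fun g : Equiv.Perm (Fin n) => h * g) ≤ J2 n := by
    unfold J2
    rw [Submodule.map_span, Submodule.span_le]
    rintro _ ⟨_, ⟨pq, rfl⟩, rfl⟩
    refine Submodule.subset_span ⟨(pq.1, ⇑h⁻¹ ∘ pq.2), ?_⟩
    funext g
    have hiff : (⇑g ∘ pq.1 = ⇑h⁻¹ ∘ pq.2) ↔ (⇑(h * g) ∘ pq.1 = pq.2) := by
      rw [Equiv.Perm.coe_mul, Function.comp_assoc]
      constructor
      · intro H
        rw [H]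
        funext i
        simp
      · intro H
        rw [← H]
        funext i
        simp
    simp only [gen, LinearMap.funLeft_apply]
    by_cases H : ⇑g ∘ pq.1 = ⇑h⁻¹ ∘ pq.2
    · rw [if_pos H, if_pos (hiff.1 H)]
    · rw [if_neg H, if_neg (fun H' => H (hiff.2 H'))]
  exact hmap (Submodule.mem_map_of_mem hf)

/-- `dim J₂ ≤ n!`. -/
theorem finrank_J2_le_factorial : finrank ℂ (J2 n) ≤ n.factorial := by
  calc finrank ℂ (J2 n) ≤ finrank ℂ (Equiv.Perm (Fin n) → ℂ) := Submodule.finrank_le _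
    _ = n.factorial := by
      rw [Module.finrank_fintype_fun_eq_card ℂ, Fintype.card_perm, Fintype.card_fin]

end TokenSpace

/-! ## An explicit spanning family: `dim J₂(𝔖_{m+1}) ≤ 1 + (m² + C(m,2)(m²-m))` -/

section Dim

variable (m : ℕ)

/-- one-token indicator `[g i = a]`. -/
def one' (i a : Fin (m + 1)) : Equiv.Perm (Fin (m + 1)) → ℂ := fun g => if g i = a then 1 else 0

/-- two-token indicator `[g i = a ∧ g j = b]`. -/
def two' (i j a b : Fin (m + 1)) : Equiv.Perm (Fin (m + 1)) → ℂ :=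
  fun g => if g i = a ∧ g j = b then 1 else 0

/-- Index type of the spanning family: the constant, the one-token indicators with index and
value `< m`, and the two-token indicators with indices `i < j < m` and values `a ≠ b < m`. -/
abbrev Idx : Type :=
  Unit ⊕ (Fin m × Fin m) ⊕
    (↥((Finset.univ : Finset (Fin m)).powersetCard 2) × ↥((Finset.univ : Finset (Fin m)).offDiag))

/-- The spanning family (a 2-subset `s` is read as the ordered pair `(min s, max s)`). -/
def fam : Idx m → (Equiv.Perm (Fin (m + 1)) → ℂ)
  | Sum.inl _ => fun _ => 1
  | Sum.inr (Sum.inl ia) => one' m (Fin.castSucc ia.1) (Fin.castSucc ia.2)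
  | Sum.inr (Sum.inr se) =>
      two' m (Fin.castSucc (se.1.1.min' (Finset.card_pos.1
          (by have h := (Finset.mem_powersetCard.1 se.1.2).2; omega))))
        (Fin.castSucc (se.1.1.max' (Finset.card_pos.1
          (by have h := (Finset.mem_powersetCard.1 se.1.2).2; omega))))
        (Fin.castSucc se.2.1.1) (Fin.castSucc se.2.1.2)

/-- The span of the family. -/
def T : Submodule ℂ (Equiv.Perm (Fin (m + 1)) → ℂ) := Submodule.span ℂ (Set.range (fam m))

variable {m}

/-- the constant is in `T`. -/
theorem const_mem : (fun _ : Equiv.Perm (Fin (m + 1)) => (1 : ℂ)) ∈ T m :=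
  Submodule.subset_span ⟨Sum.inl (), rfl⟩

/-- `[g i = a] ∈ T` for `i, a < m`. -/
theorem one_cs_cs_mem (i a : Fin m) : one' m (Fin.castSucc i) (Fin.castSucc a) ∈ T m :=
  Submodule.subset_span ⟨Sum.inr (Sum.inl (i, a)), rfl⟩

/-- `[g i = a ∧ g j = b] ∈ T` for `i < j < m`, `a ≠ b < m`. -/
theorem two_cs_mem_of_lt {i j : Fin m} (hij : i < j) {a b : Fin m} (hab : a ≠ b) :
    two' m (Fin.castSucc i) (Fin.castSucc j) (Fin.castSucc a) (Fin.castSucc b) ∈ T m := by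
  have hs : ({i, j} : Finset (Fin m)) ∈ (Finset.univ : Finset (Fin m)).powersetCard 2 := by
    rw [Finset.mem_powersetCard]
    exact ⟨Finset.subset_univ _, Finset.card_pair hij.ne⟩
  have he : (a, b) ∈ (Finset.univ : Finset (Fin m)).offDiag := by
    simp [Finset.mem_offDiag, hab]
  have hmin : ∀ hne, ({i, j} : Finset (Fin m)).min' hne = i := fun hne =>
    le_antisymm (Finset.min'_le _ _ (by simp)) (Finset.le_min' _ _ _ fun y hy => by
      simp only [Finset.mem_insert, Finset.mem_singleton] at hy
      rcases hy with rfl | rfl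
      exacts [le_rfl, hij.le])
  have hmax : ∀ hne, ({i, j} : Finset (Fin m)).max' hne = j := fun hne =>
    le_antisymm (Finset.max'_le _ _ _ fun y hy => by
      simp only [Finset.mem_insert, Finset.mem_singleton] at hy
      rcases hy with rfl | rfl
      exacts [hij.le, le_rfl]) (Finset.le_max' _ _ (by simp))
  refine Submodule.subset_span ⟨Sum.inr (Sum.inr (⟨{i, j}, hs⟩, ⟨(a, b), he⟩)), ?_⟩
  simp only [fam, hmin, hmax]

/-- symmetry `[g i = a ∧ g j = b] = [g j = b ∧ g i = a]`. -/
theorem two_comm (i j a b : Fin (m + 1)) : two' m i j a b = two' m j i b a := by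
  funext g
  by_cases h1 : g i = a <;> by_cases h2 : g j = b <;> simp [two', h1, h2]

/-- `[g i = a ∧ g j = a] = 0` for `i ≠ j`. -/
theorem two_same_val {i j : Fin (m + 1)} (hij : i ≠ j) (a : Fin (m + 1)) : two' m i j a a = 0 := by
  funext g
  simp only [two', Pi.zero_apply]
  rw [if_neg]
  rintro ⟨h1, h2⟩
  exact hij (g.injective (h1.trans h2.symm))

/-- `[g i = a ∧ g i = b] = [a = b]·[g i = a]`. -/
theorem two_same_idx (i a b : Fin (m + 1)) :
    two' m i i a b = if a = b then one' m i a else 0 := by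
  funext g
  by_cases hab : a = b
  · subst hab
    simp [two', one']
  · simp only [two', hab, if_false, Pi.zero_apply]
    rw [if_neg]
    rintro ⟨h1, h2⟩
    exact hab (h1.symm.trans h2)

/-- `Σ_a [g i = a] = 1`. -/
theorem sum_one_val (i : Fin (m + 1)) : ∑ a, one' m i a = fun _ => 1 := by
  funext g
  simp [one', Finset.sum_apply]

/-- `Σ_i [g i = a] = 1`. -/
theorem sum_one_idx (a : Fin (m + 1)) : ∑ i, one' m i a = fun _ => 1 := by
  funext g
  simp [one', Finset.sum_apply, Equiv.apply_eq_iff_eq_symm_apply]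

/-- `Σ_b [g i = a ∧ g j = b] = [g i = a]`. -/
theorem sum_two_val (i j a : Fin (m + 1)) : ∑ b, two' m i j a b = one' m i a := by
  funext g
  by_cases h : g i = a <;> simp [two', one', Finset.sum_apply, h]

/-- `Σ_j [g i = a ∧ g j = b] = [g i = a]`. -/
theorem sum_two_idx (i a b : Fin (m + 1)) : ∑ j, two' m i j a b = one' m i a := by
  funext g
  by_cases h : g i = a
  · simp [two', one', Finset.sum_apply, h, Equiv.apply_eq_iff_eq_symm_apply]
  · simp [two', one', Finset.sum_apply, h]

/-- `[g i = last] ∈ T` for `i < m`. -/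
theorem one_cs_last_mem (i : Fin m) : one' m (Fin.castSucc i) (Fin.last m) ∈ T m := by
  have h := sum_one_val (m := m) (Fin.castSucc i)
  rw [Fin.sum_univ_castSucc, ← eq_sub_iff_add_eq'] at h
  rw [h]
  exact Submodule.sub_mem _ const_mem (Submodule.sum_mem _ fun a _ => one_cs_cs_mem i a)

/-- `[g last = a] ∈ T` for `a < m`. -/
theorem one_last_cs_mem (a : Fin m) : one' m (Fin.last m) (Fin.castSucc a) ∈ T m := by
  have h := sum_one_idx (m := m) (Fin.castSucc a)
  rw [Fin.sum_univ_castSucc, ← eq_sub_iff_add_eq'] at h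
  rw [h]
  exact Submodule.sub_mem _ const_mem (Submodule.sum_mem _ fun i _ => one_cs_cs_mem i a)

/-- `[g last = last] ∈ T`. -/
theorem one_last_last_mem : one' m (Fin.last m) (Fin.last m) ∈ T m := by
  have h := sum_one_idx (m := m) (Fin.last m)
  rw [Fin.sum_univ_castSucc, ← eq_sub_iff_add_eq'] at h
  rw [h]
  exact Submodule.sub_mem _ const_mem (Submodule.sum_mem _ fun i _ => one_cs_last_mem i)

/-- every one-token indicator is in `T`. -/
theorem one_mem (i a : Fin (m + 1)) : one' m i a ∈ T m := by
  rcases Fin.eq_castSucc_or_eq_last i with ⟨i, rfl⟩ | rfl <;>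
    rcases Fin.eq_castSucc_or_eq_last a with ⟨a, rfl⟩ | rfl
  exacts [one_cs_cs_mem i a, one_cs_last_mem i, one_last_cs_mem a, one_last_last_mem]

/-- two-token indicators with all four parameters `< m` are in `T`. -/
theorem two_cs4_mem {i j : Fin m} (hij : i ≠ j) (a b : Fin m) :
    two' m (Fin.castSucc i) (Fin.castSucc j) (Fin.castSucc a) (Fin.castSucc b) ∈ T m := by
  by_cases hab : a = b
  · subst hab
    rw [two_same_val ((Fin.castSucc_injective m).ne hij)]
    exact Submodule.zero_mem _
  rcases lt_or_gt_of_ne hij with hlt | hlt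
  · exact two_cs_mem_of_lt hlt hab
  · rw [two_comm]
    exact two_cs_mem_of_lt hlt (Ne.symm hab)

/-- `[g i = a ∧ g j = last] ∈ T` for `i ≠ j < m`, `a < m`. -/
theorem two_cs_cs_cs_last_mem {i j : Fin m} (hij : i ≠ j) (a : Fin m) :
    two' m (Fin.castSucc i) (Fin.castSucc j) (Fin.castSucc a) (Fin.last m) ∈ T m := by
  have h := sum_two_val (m := m) (Fin.castSucc i) (Fin.castSucc j) (Fin.castSucc a)
  rw [Fin.sum_univ_castSucc, ← eq_sub_iff_add_eq'] at h
  rw [h]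
  exact Submodule.sub_mem _ (one_cs_cs_mem i a)
    (Submodule.sum_mem _ fun b _ => two_cs4_mem hij a b)

/-- two-token indicators with both indices `< m` are in `T`. -/
theorem two_cs_cs_mem {i j : Fin m} (hij : i ≠ j) (a b : Fin (m + 1)) :
    two' m (Fin.castSucc i) (Fin.castSucc j) a b ∈ T m := by
  rcases Fin.eq_castSucc_or_eq_last a with ⟨a, rfl⟩ | rfl <;>
    rcases Fin.eq_castSucc_or_eq_last b with ⟨b, rfl⟩ | rfl
  · exact two_cs4_mem hij a b
  · exact two_cs_cs_cs_last_mem hij a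
  · rw [two_comm]
    exact two_cs_cs_cs_last_mem (Ne.symm hij) b
  · rw [two_same_val ((Fin.castSucc_injective m).ne hij)]
    exact Submodule.zero_mem _

/-- two-token indicators with indices `(i, last)`, `i < m`, are in `T`. -/
theorem two_cs_last_mem (i : Fin m) (a b : Fin (m + 1)) :
    two' m (Fin.castSucc i) (Fin.last m) a b ∈ T m := by
  by_cases hab : a = b
  · subst hab
    rw [two_same_val (Fin.castSucc_lt_last i).ne]
    exact Submodule.zero_mem _
  have h := sum_two_idx (m := m) (Fin.castSucc i) a b
  rw [Fin.sum_univ_castSucc, ← eq_sub_iff_add_eq'] at h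
  rw [h]
  refine Submodule.sub_mem _ (one_mem _ _) (Submodule.sum_mem _ fun j _ => ?_)
  by_cases hji : i = j
  · subst hji
    rw [two_same_idx, if_neg hab]
    exact Submodule.zero_mem _
  · exact two_cs_cs_mem hji a b

/-- every two-token indicator is in `T`. -/
theorem two_mem (i j a b : Fin (m + 1)) : two' m i j a b ∈ T m := by
  rcases Fin.eq_castSucc_or_eq_last i with ⟨i, rfl⟩ | rfl <;>
    rcases Fin.eq_castSucc_or_eq_last j with ⟨j, rfl⟩ | rfl
  · by_cases hij : i = j
    · subst hij
      rw [two_same_idx]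
      by_cases hab : a = b
      · rw [if_pos hab]; exact one_mem _ _
      · rw [if_neg hab]; exact Submodule.zero_mem _
    · exact two_cs_cs_mem hij a b
  · exact two_cs_last_mem i a b
  · rw [two_comm]
    exact two_cs_last_mem j b a
  · rw [two_same_idx]
    by_cases hab : a = b
    · rw [if_pos hab]; exact one_mem _ _
    · rw [if_neg hab]; exact Submodule.zero_mem _

/-- the generators of `J₂` are two-token indicators. -/
theorem gen_eq_two (pq : (Fin 2 → Fin (m + 1)) × (Fin 2 → Fin (m + 1))) :
    gen (m + 1) pq = two' m (pq.1 0) (pq.1 1) (pq.2 0) (pq.2 1) := by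
  funext g
  unfold gen two'
  by_cases H : g (pq.1 0) = pq.2 0 ∧ g (pq.1 1) = pq.2 1
  · rw [if_pos H, if_pos]
    funext x
    fin_cases x
    exacts [H.1, H.2]
  · rw [if_neg H, if_neg]
    intro H'
    exact H ⟨congrFun H' 0, congrFun H' 1⟩

/-- `J₂(𝔖_{m+1}) ≤ T`. -/
theorem J2_le_T : J2 (m + 1) ≤ T m := by
  unfold J2
  rw [Submodule.span_le]
  rintro _ ⟨pq, rfl⟩
  rw [SetLike.mem_coe, gen_eq_two]
  exact two_mem _ _ _ _

/-- **`dim J₂(𝔖_{m+1}) ≤ 1 + (m² + C(m,2)·(m² - m))`.** -/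
theorem finrank_J2_succ_le :
    finrank ℂ (J2 (m + 1)) ≤ 1 + (m * m + m.choose 2 * (m * m - m)) := by
  calc finrank ℂ (J2 (m + 1)) ≤ finrank ℂ (T m) := Submodule.finrank_mono J2_le_T
    _ ≤ Fintype.card (Idx m) := by
      unfold T
      exact finrank_range_le_card (R := ℂ) (fam m)
    _ = 1 + (m * m + m.choose 2 * (m * m - m)) := by
      simp only [Idx, Fintype.card_sum, Fintype.card_prod, Fintype.card_unit, Fintype.card_fin,
        Fintype.card_coe, Finset.card_powersetCard, Finset.offDiag_card, Finset.card_univ]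

end Dim

end Summit.MatrixMultiplication.MatrixMultiplication.Theorems.LevelTwoBeatsCubes.Negative
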